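import Summits.QuantumAdvantage.QuantumAdvantage.Theorems.LinnikCubicClassGroupsDegreeOnePrimesEscapeClassWindowDHCore
import Summits.QuantumAdvantage.QuantumAdvantage.Theorems.LinnikCubicClassGroupsDegreeOnePrimesEscapeFrobeniusWindowDHNumerics
import Summits.QuantumAdvantage.QuantumAdvantage.Theorems.LinnikCubicClassGroupsDegreeOnePrimesEscapeFrobeniusWindowDHCore
import Summits.QuantumAdvantage.QuantumAdvantage.Theorems.LinnikCubicClassGroupsDegreeOnePrimesEscapeClassPNTDHInputs
import Summits.QuantumAdvantage.QuantumAdvantage.Theorems.LinnikCubicClassGroupsDegreeOnePrimesEscapeClassPNTTheta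
import Literature.NumberTheory.LFunctions.DeuringHeilbronn
import Literature.NumberTheory.LFunctions.ClassGroupLFunctionInversion
import HarnessLib

/-!
# Prime ideals of a class in short intervals with Deuring–Heilbronn, II: the window dichotomy

Topic `Summits/QuantumAdvantage/QuantumAdvantage/Theorems`, cell B2b-1 (linnik-cubic), PART A (gen 19); helper
toward the crux `DegreeOnePrimesEscape` (stmt-QuantumAdvantage-11543) — the DEURING–HEILBRONN-SHARP HOHEISEL–LINNIK
THEOREM FOR IDEAL CLASSES.  HONEST FRAMING: value = THEOREM (kernel-checked lemma) — NOT summit progress.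

`classWindow_dichotomy_dh` (ideal-class analogue of `frobWindow_dichotomy_dh`, gen 17): for `n > 1`, precision `κ > 0`,
collar floor `0 < e₀ ≤ 1/4` there are `θ, a₁, c` such that for every number field `K` of degree `n`, collar ratio
`e₀Q^{−2} ≤ ε₀ ≤ 1/4`, `x ≥ Q^{a₁}`, `0 < η ≤ log 2` with `x^{−θ/8} ≤ 2η`, window `log x ≤ lo < hi ≤ log x + η`
(`g = windowTest lo hi (ε₀η)`, `F` its Laplace transform) and class `C`:
(A) no real zero of a real class group character in `(1 − c/(log|d_K| + log 4), 1)` ⇒ `‖h_K ψ̃_C(g) − F(−1)‖ ≤ κxη`;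
(B) `χ₁` real with the zero `β₁` there ⇒ `‖h_K ψ̃_C(g) − F(−1) + χ₁(C) F(−β₁)‖ ≤ κxη · min(1, (1−β₁) log x)`.
The gain in (B) is the Deuring–Heilbronn phenomenon (`deuringHeilbronn`, via `zfr_of_zeroRepulsion`, `dh_flat_le`)
with Stark's `1 − β₁ ≥ c₁Q^{−2}` for the secondary terms (`dh_junk_le`); Landau–Page, the log-free density and the
residue bound are discharged inside.
References: [LagariasMontgomeryOdlyzko1979, §7, Thm. 5.1]; [ThornerZaman2019, Thm. 3.1, §5]; G. Hoheisel (1930).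
-/

noncomputable section

open Complex Real MeasureTheory Set Filter Topology
open scoped NumberField nonZeroDivisors

namespace Summit.QuantumAdvantage.QuantumAdvantage.Theorems.DegreeOnePrimesEscape

open Literature.NumberTheory.LFunctions Literature.NumberTheory.LFunctions.NumberField
  Literature.NumberTheory.LFunctions.EntireEF Literature.NumberTheory.LFunctions.WindowWeight
  Literature.NumberTheory.LFunctions.AbelianDensity

variable {K : Type} [Field K] [NumberField K]

/-! ### Small lemmas -/

/-- A zero `ρ ≠ 1` of `L(s, χ_ψ)` is a zero of the member `F_ψ` of the family (converse of
`classGroupLFunction_eq_zero_of_famF`). [folklore] -/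
theorem famF_eq_zero_of_classGroupLFunction (ψ : AddChar (Additive (ClassGroup (𝓞 K))) ℂ) {ρ : ℂ}
    (hρ1 : ρ ≠ 1) (h0 : classGroupLFunction K (toMulHom ψ).toHomUnits ρ = 0) : famF K ψ ρ = 0 := by
  by_cases hψ : ψ = 0
  · subst hψ
    rw [famF_zero]
    rw [toHomUnits_toMulHom_zero] at h0
    by_contra hne
    exact ((dedekindZeta₁_ne_zero_iff (K := K) hρ1).1 hne) h0
  · rw [famF_of_ne hψ, classGroupLFunction₀_eq _ hρ1 (toHomUnits_ne_one hψ)]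
    exact h0

set_option maxHeartbeats 3200000 in
/-- **The smoothed class-sum window dichotomy, Deuring–Heilbronn form** (see the module docstring):
(A) error `κ x η` without a real zero of a real class group character in the `c`-window;
(B) error `κ x η · min(1, (1−β₁) log x)` with one, the exceptional term being `χ₁(C) F(−β₁)`. -/
theorem classWindow_dichotomy_dh (n : ℕ) (hn : 1 < n) {κ : ℝ} (hκ : 0 < κ) {e₀ : ℝ} (he₀ : 0 < e₀)
    (he₀1 : e₀ ≤ 1 / 4) :
    ∃ θ a₁ c : ℝ, 0 < θ ∧ θ ≤ 1 / 8 ∧ 1 ≤ a₁ ∧ 0 < c ∧ c ≤ 1 / (8 * ((n : ℝ) ^ 2 + 1)) ∧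
    ∀ (K : Type) [Field K] [NumberField K], Module.finrank ℚ K = n →
      ∀ ε₀ : ℝ, e₀ * ThornerZaman.condQn K ^ (-(2 : ℝ)) ≤ ε₀ → ε₀ ≤ 1 / 4 →
      ∀ x η : ℝ, ThornerZaman.condQn K ^ a₁ ≤ x → 0 < η → η ≤ Real.log 2 →
        Real.exp (-(θ / 8) * Real.log x) ≤ 2 * η →
      ∀ lo hi : ℝ, Real.log x ≤ lo → lo < hi → hi ≤ Real.log x + η →
      ((¬ ∃ (χ₁ : ClassGroup (𝓞 K) →* ℂˣ) (β₁ : ℝ), χ₁ * χ₁ = 1 ∧ classGroupLFunction K χ₁ β₁ = 0 ∧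
            1 - c / (Real.log ((NumberField.discr K).natAbs : ℝ) + Real.log 4) < β₁ ∧ β₁ < 1) →
          ∀ C : ClassGroup (𝓞 K),
          ‖(NumberField.classNumber K : ℂ) * (smoothedPsiClass K C (windowTest lo hi (ε₀ * η)) : ℂ) -
              fordLaplace (windowTest lo hi (ε₀ * η)) (-1)‖ ≤ κ * x * η) ∧
      (∀ (χ₁ : ClassGroup (𝓞 K) →* ℂˣ) (β₁ : ℝ), χ₁ * χ₁ = 1 → classGroupLFunction K χ₁ β₁ = 0 →
          1 - c / (Real.log ((NumberField.discr K).natAbs : ℝ) + Real.log 4) < β₁ → β₁ < 1 →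
          ∀ C : ClassGroup (𝓞 K),
            ‖(NumberField.classNumber K : ℂ) * (smoothedPsiClass K C (windowTest lo hi (ε₀ * η)) : ℂ) -
                fordLaplace (windowTest lo hi (ε₀ * η)) (-1) +
                (χ₁ C : ℂ) * fordLaplace (windowTest lo hi (ε₀ * η)) (-(β₁ : ℂ))‖ ≤
              κ * x * η * min 1 ((1 - β₁) * Real.log x)) := by
  classical
  obtain ⟨c₀, hc₀, hpackAll⟩ := exists_exceptionalZero_const n
  obtain ⟨Al, hAl0, hAl⟩ := exists_norm_logDeriv_classGroupLFunction_left_le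
  obtain ⟨M, hM1, hM⟩ := TZWeight.exists_smoothTransition_deriv_bound
  obtain ⟨hc₁16, hc₂0⟩ := tailConst_nonneg
  obtain ⟨C, hC, hDH'⟩ := deuringHeilbronn
  obtain ⟨c₁, hc₁, hc₁1, heff⟩ := Residue.one_sub_realZero_ge_condQn_rpow n hn
  obtain ⟨A, -, hA⟩ := Residue.residueLowerBound_all n
  obtain ⟨b, D, hb, hD, hdensAll⟩ := fam_density_local n hn A
  have hlC := leftLineConst_nonneg
  have hn2 : (2 : ℝ) ≤ n := by exact_mod_cast hn
  have hn0 : (0 : ℝ) < n := by linarith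
  have hM0 : 0 ≤ M := by linarith
  set a : ℝ := max A 4 with hadef
  have ha4 : (4 : ℝ) ≤ a := le_max_right _ _
  have ha : (1 : ℝ) ≤ a := by linarith
  set c : ℝ := min c₀ (1 / (8 * ((n : ℝ) ^ 2 + 1))) with hcdef
  have hc : 0 < c := lt_min hc₀ (by positivity)
  have hcc₀ : c ≤ c₀ := min_le_left _ _
  have hcn : c ≤ 1 / (8 * ((n : ℝ) ^ 2 + 1)) := min_le_right _ _
  set cu : ℝ := min 1 (1 / (6 * C * n)) with hcu
  have hcu0 : 0 < cu := lt_min one_pos (by positivity)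
  have hcu1 : cu ≤ 1 := min_le_left _ _
  have hcuC : cu ≤ 1 / (6 * C * n) := min_le_right _ _
  set tA : ℝ := κ * cu / 9 with htA
  set tB : ℝ := κ / 9 with htB
  have htA0 : 0 < tA := by positivity
  have htB0 : 0 < tB := by positivity
  -- the exponent `θ`
  set ΛA : ℝ := Real.log (2 * Real.exp 1 * D / tA + 3) with hΛA
  have hΛAarg : 1 < 2 * Real.exp 1 * D / tA + 3 := by
    have : 0 < 2 * Real.exp 1 * D / tA := (by positivity); linarith
  have hΛA0 : 0 < ΛA := Real.log_pos hΛAarg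
  set K₃ : ℝ := 2 + max 0 (Real.log (4 * Real.exp 1 * D * C * n / tB)) / Real.log 3 with hK₃
  set K₄ : ℝ := 2 + max 0 (Real.log (2 * Real.exp 1 * D / (tB * c₁))) / Real.log 12 with hK₄
  have hlog3 : 0 < Real.log 3 := Real.log_pos (by norm_num)
  have hlog12 : 0 < Real.log 12 := Real.log_pos (by norm_num)
  have hK₃0 : 2 ≤ K₃ := by
    have : 0 ≤ max 0 (Real.log (4 * Real.exp 1 * D * C * n / tB)) / Real.log 3 := (by positivity); linarith
  have hK₄0 : 2 ≤ K₄ := by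
    have : 0 ≤ max 0 (Real.log (2 * Real.exp 1 * D / (tB * c₁))) / Real.log 12 := (by positivity); linarith
  set θ : ℝ := min (min (1 / (8 * b)) (1 / 8)) (min (c / (6 * ΛA)) (min (1 / (6 * C * n * K₃)) (a / (12 * K₄))))
    with hθ
  have hθ0 : 0 < θ := by positivity
  have hθb : θ * b ≤ 1 / 8 := by
    have h1 : θ ≤ 1 / (8 * b) := (min_le_left _ _).trans (min_le_left _ _)
    calc θ * b ≤ 1 / (8 * b) * b := mul_le_mul_of_nonneg_right h1 hb.le
      _ = 1 / 8 := by field_simp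
  have hθ1 : θ ≤ 1 / 8 := (min_le_left _ _).trans (min_le_right _ _)
  have hθΛ : θ ≤ c / (6 * ΛA) := (min_le_right _ _).trans (min_le_left _ _)
  have hθK₃ : θ ≤ 1 / (6 * C * n * K₃) := (min_le_right _ _).trans ((min_le_right _ _).trans (min_le_left _ _))
  have hθK₄ : θ ≤ a / (12 * K₄) := (min_le_right _ _).trans ((min_le_right _ _).trans (min_le_right _ _))
  have hflatA : 2 * Real.exp 1 * D * Real.exp (-(c / (6 * θ))) ≤ tA :=
    flat_le_of_theta_le hD hθ0 htA0 (by rw [← hΛA]; exact hθΛ)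
  have hθK₃' : 6 * θ * C * n * (2 + max 0 (Real.log (4 * Real.exp 1 * D * C * n / tB)) / Real.log 3) ≤ 1 := by
    rw [← hK₃]; have := (le_div_iff₀ (by positivity : (0:ℝ) < 6 * C * n * K₃)).1 hθK₃; linarith
  have hθK₄' : 12 * θ * (2 + max 0 (Real.log (2 * Real.exp 1 * D / (tB * c₁))) / Real.log 12) ≤ a := by
    rw [← hK₄]; have := (le_div_iff₀ (by positivity : (0:ℝ) < 12 * K₄)).1 hθK₄; linarith
  -- the absorption constant and the threshold
  set W₀ : ℝ := 512 * ((n : ℝ) + 1) with hW₀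
  have hW₀0 : 0 < W₀ := by positivity
  set CJ : ℝ := 338 * W₀ + 96 * (M / (4 * e₀)) * W₀ * (4 * tailConst₁ + tailConst₂) + 108 +
    640 * leftLineConst * Al * (M / (4 * e₀)) with hCJ
  have hc₁0 : 0 ≤ tailConst₁ := by linarith
  have hCJ0 : 0 ≤ CJ := by rw [hCJ]; positivity
  obtain ⟨a₁', ha₁'1, habsAll⟩ := absorb_junk (2 * 1 * CJ / (κ * c₁)) (θ / 2) (by positivity) (by positivity)
    (by linarith)
  set a₁ : ℝ := max (max a₁' (32 / θ)) (max (a / θ) 64) with ha₁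
  have ha₁a' : a₁' ≤ a₁ := le_trans (le_max_left _ _) (le_max_left _ _)
  have ha₁32 : 32 / θ ≤ a₁ := le_trans (le_max_right _ _) (le_max_left _ _)
  have ha₁aθ : a / θ ≤ a₁ := le_trans (le_max_left _ _) (le_max_right _ _)
  have ha₁64 : (64 : ℝ) ≤ a₁ := le_trans (le_max_right _ _) (le_max_right _ _)
  have ha₁1 : 1 ≤ a₁ := by linarith
  refine ⟨θ, a₁, c, hθ0, hθ1, ha₁1, hc, hcn, ?_⟩
  intro K _ _ hKn ε₀ hε₀Q hε₀1 x η hx hη0 hη1 hηx lo hi hlo hlohi hhi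
  have hK : 1 < Module.finrank ℚ K := by rw [hKn]; exact hn
  have hQ12 : (12 : ℝ) ≤ ThornerZaman.condQn K := ThornerZaman.twelve_le_condQn (K := K) hK
  have hQ1 : (1 : ℝ) < ThornerZaman.condQn K := by linarith
  have hQ0 : (0 : ℝ) < ThornerZaman.condQn K := by linarith
  obtain ⟨-, -, hlog12'⟩ := log_small_consts
  have hlogQ : 2 ≤ Real.log (ThornerZaman.condQn K) := hlog12'.trans (Real.log_le_log (by norm_num) hQ12)
  have hQm2pos : 0 < ThornerZaman.condQn K ^ (-(2 : ℝ)) := Real.rpow_pos_of_pos hQ0 _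
  have hQm2le : ThornerZaman.condQn K ^ (-(2 : ℝ)) ≤ 1 := Real.rpow_le_one_of_one_le_of_nonpos hQ1.le (by norm_num)
  have hε₀0 : 0 < ε₀ := lt_of_lt_of_le (mul_pos he₀ hQm2pos) hε₀Q
  have hdens := hdensAll K hKn (hA K hKn)
  have hxa₁' : ThornerZaman.condQn K ^ a₁' ≤ x :=
    (Real.rpow_le_rpow_of_exponent_le hQ1.le ha₁a').trans hx
  have hxaθ : ThornerZaman.condQn K ^ (a / θ) ≤ x :=
    (Real.rpow_le_rpow_of_exponent_le hQ1.le ha₁aθ).trans hx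
  have hx32 : ThornerZaman.condQn K ^ (32 / θ) ≤ x :=
    (Real.rpow_le_rpow_of_exponent_le hQ1.le ha₁32).trans hx
  have hQx : ThornerZaman.condQn K ≤ x := by
    have := (Real.rpow_le_rpow_of_exponent_le hQ1.le ha₁1).trans hx; rwa [Real.rpow_one] at this
  have hx1 : 1 < x := by linarith
  have hx0 : 0 < x := by linarith
  have hL0 : 0 < Real.log x := Real.log_pos hx1
  have hxexp : Real.exp (Real.log x) = x := Real.exp_log hx0
  have hLQ : a₁ * Real.log (ThornerZaman.condQn K) ≤ Real.log x := by
    have := Real.log_le_log (by positivity) hx; rwa [Real.log_rpow (by linarith)] at this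
  have hL64 : 64 ≤ Real.log x := by nlinarith
  have haθ : a * Real.log (ThornerZaman.condQn K) ≤ θ * Real.log x := by
    have h1 := Real.log_le_log (by positivity) hxaθ
    rw [Real.log_rpow (by linarith)] at h1
    have h2 : θ * (a / θ * Real.log (ThornerZaman.condQn K)) = a * Real.log (ThornerZaman.condQn K) := by field_simp
    have h3 := mul_le_mul_of_nonneg_left h1 hθ0.le
    linarith
  have h2θ : 2 ≤ θ * Real.log x := by
    have := mul_le_mul ha hlogQ (by norm_num) (by linarith : (0 : ℝ) ≤ a); linarith
  -- the junk: `κ₂ ≤ (κ c₁/2) Q^{-2}`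
  have hQ4 : ThornerZaman.condQn K ^ (4 : ℕ) * x ^ (-(θ / 8)) ≤ 1 := pow_four_mul_rpow_le_one hQ0 hx0 hθ0 hx32
  have habs' := habsAll (ThornerZaman.condQn K) x hQ12 hxa₁'
  rw [show -(θ / 2 / 4) = -(θ / 8) by ring] at habs'
  have hjunk1 : (1 : ℝ) * ((338 * W₀ + 96 * (M / (4 * ε₀)) * W₀ * (4 * tailConst₁ + tailConst₂) + 108 +
      640 * leftLineConst * Al * (M / (4 * ε₀))) * ThornerZaman.condQn K ^ (7 : ℕ) * (Real.log x + 1) *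
      Real.exp (-(θ / 4) * Real.log x)) ≤ κ * c₁ / 2 * ThornerZaman.condQn K ^ (-(2 : ℝ)) :=
    dh_junk_le one_pos hW₀0.le hM0 hc₁0 hc₂0 hlC hAl0.le he₀ hε₀Q hQ12 hx0 hκ hc₁ (by rw [← hCJ]; exact habs')
      hQ4 hL0.le
  rw [one_mul, hW₀] at hjunk1
  -- the window and the height `T₁ = X^θ ≤ x`
  set ε : ℝ := ε₀ * η with hε
  have hlog2 : Real.log 2 < 0.6931471808 := Real.log_two_lt_d9
  have hLX0 : 0 ≤ hi + ε := by have : 0 < ε := (by positivity); linarith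
  have hT₁x : Real.exp (θ * (hi + ε)) ≤ x := by
    rw [← hxexp]
    refine Real.exp_le_exp.2 ?_
    have h1 : θ * (hi + ε) ≤ 1 / 8 * (hi + ε) := mul_le_mul_of_nonneg_right hθ1 hLX0
    have hε1 : ε ≤ 1 := by rw [hε]; have := mul_le_mul hε₀1 hη1 hη0.le (by norm_num); linarith
    linarith [hL64]
  have hlogd0 : 0 ≤ Real.log ((NumberField.discr K).natAbs : ℝ) := Real.log_natCast_nonneg _
  have hlog4 : 0 ≤ Real.log 4 := Real.log_nonneg (by norm_num)
  -- the Landau–Page package of `K`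
  obtain ⟨hLPreal, hLPuniq, hLPsimple⟩ := hpackAll K hKn
  have hpack_c := pack_of_le (K := K) hcc₀ hLPreal
  have hexcZ : ∀ ψ ρ, famF K ψ ρ = 0 → excRegion c K ρ →
      (((toMulHom ψ).toHomUnits = 1 → dedekindZeta₁ K ρ = 0) ∧
        ((toMulHom ψ).toHomUnits ≠ 1 → classGroupLFunction₀ K (toMulHom ψ).toHomUnits ρ = 0)) ∧
        1 - c₀ / (Real.log ((NumberField.discr K).natAbs : ℝ) + Real.log (|ρ.im| + 4)) < ρ.re := by
    intro ψ ρ h0 hexc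
    refine ⟨famZ_of_famF_eq_zero ψ h0, lpRegion_mono hcc₀ ?_⟩
    obtain ⟨him, hre⟩ := hexc
    rw [him, abs_zero, zero_add]; exact hre
  -- the classical zero-free region off the exceptional segment, in `Q`-form
  have hzfr_c := zfr_classical_of_pack (N := K) hc ha hpack_c (T := Real.exp (θ * (hi + ε)))
  -- the core estimate with a zero-free constant `cZ` (`…ClassWindowDHCore.lean`)
  have hcore : ∀ (cZ : ℝ), 0 < cZ →
      (∀ (ψ : AddChar (Additive (ClassGroup (𝓞 K))) ℂ) (ρ : ℂ), famF K ψ ρ = 0 → 1 / 4 ≤ ρ.re →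
        ρ.re < 1 → |ρ.im| ≤ Real.exp (θ * (hi + ε₀ * η)) → ¬ excRegion c K ρ →
          ρ.re ≤ 1 - cZ / (a * Real.log (ThornerZaman.condQn K) + Real.log (|ρ.im| + 4))) →
      ∀ (C : ClassGroup (𝓞 K)) (Exc : AddChar (Additive (ClassGroup (𝓞 K))) ℂ → Finset ℂ),
      (∀ ψ, ∀ ρ ∈ Exc ψ, famF K ψ ρ = 0 ∧ 0 < ρ.re ∧ ρ.re < 1) →
      (∀ ψ ρ, famF K ψ ρ = 0 → 0 < ρ.re → ρ.re < 1 → excRegion c K ρ → ρ ∈ Exc ψ) →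
      ‖(NumberField.classNumber K : ℂ) * (smoothedPsiClass K C (windowTest lo hi (ε₀ * η)) : ℂ) -
          fordLaplace (windowTest lo hi (ε₀ * η)) (-1) +
          ∑ ψ : AddChar (Additive (ClassGroup (𝓞 K))) ℂ, ψ (Additive.ofMul C⁻¹) *
            ∑ ρ ∈ Exc ψ, (famMult K ψ ρ : ℂ) * fordLaplace (windowTest lo hi (ε₀ * η)) (-ρ)‖ ≤
        (9 / 2 * (2 * Real.exp 1 * D * Real.exp (-(cZ / (6 * θ)))) +
          κ * c₁ / 2 * ThornerZaman.condQn K ^ (-(2 : ℝ))) * x * η :=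
    fun cZ hcZ hzfr C Exc hExc hExc' ↦
      classWindow_core_dh hn hKn hb hD ha hdens c hcZ hM1 hM hAl0 hAl hθ0 hθb hθ1 hx1 haθ h2θ hη0 hη1 hηx
        hlo hlohi hhi hε₀0 hε₀1 hjunk1 hzfr C Exc hExc hExc'
  clear habsAll
  -- THE DICHOTOMY
  refine ⟨fun hnoexc Cl ↦ ?_, fun χ₁ β₁ hreal hLz hβwin hβ1 Cl ↦ ?_⟩
  · -- (A) no exceptional zero: classical zero-free region, target `κ`
    have hex : ¬ ∃ (ψ : AddChar (Additive (ClassGroup (𝓞 K))) ℂ) (ρ : ℂ),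
        famF K ψ ρ = 0 ∧ 0 < ρ.re ∧ ρ.re < 1 ∧ excRegion c K ρ := by
      rintro ⟨ψ, ρ, h0, h1, h2, hexc⟩
      obtain ⟨him, hrealψ⟩ := hLPreal _ ρ (hexcZ ψ ρ h0 hexc)
      have hρ : ρ = (ρ.re : ℂ) := by apply Complex.ext <;> simp [him]
      have hρ1 : ρ ≠ 1 := fun h ↦ by rw [h] at h2; simp at h2
      have hL := classGroupLFunction_eq_zero_of_famF ψ h0 hρ1
      rw [hρ] at hL
      exact hnoexc ⟨(toMulHom ψ).toHomUnits, ρ.re, hrealψ, hL, hexc.2, h2⟩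
    have key := hcore c hc hzfr_c Cl (fun _ ↦ ∅) (fun ψ ρ hρ ↦ by simp at hρ)
      (fun ψ ρ h0 h1 h2 hexc ↦ absurd ⟨ψ, ρ, h0, h1, h2, hexc⟩ hex)
    simp only [Finset.sum_empty, mul_zero, Finset.sum_const_zero, add_zero] at key
    refine key.trans ?_
    have h1 : 9 / 2 * (2 * Real.exp 1 * D * Real.exp (-(c / (6 * θ)))) ≤ κ / 2 := by
      have h3 := mul_le_mul_of_nonneg_left hflatA (by norm_num : (0 : ℝ) ≤ 9 / 2)
      have e : (9 / 2 : ℝ) * tA = κ * cu / 2 := by rw [htA]; ring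
      have h4 : κ * cu ≤ κ * 1 := mul_le_mul_of_nonneg_left hcu1 hκ.le
      linarith
    have h2 : κ * c₁ / 2 * ThornerZaman.condQn K ^ (-(2 : ℝ)) ≤ κ / 2 := by
      have h3 := mul_le_mul hc₁1 hQm2le hQm2pos.le zero_le_one
      have h4 := mul_le_mul_of_nonneg_left h3 (by positivity : (0 : ℝ) ≤ κ / 2)
      linarith
    have hsum : 9 / 2 * (2 * Real.exp 1 * D * Real.exp (-(c / (6 * θ)))) +
        κ * c₁ / 2 * ThornerZaman.condQn K ^ (-(2 : ℝ)) ≤ κ := by linarith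
    exact mul_le_mul_of_nonneg_right (mul_le_mul_of_nonneg_right hsum hx0.le) hη0.le
  · -- (B) an exceptional zero `β₁` of the real character `χ₁`: real, unique, simple
    obtain ⟨ψ₁, hψ₁⟩ := exists_toHomUnits_toMulHom_eq (K := K) χ₁
    have hβ1ne : ((β₁ : ℝ) : ℂ) ≠ 1 := fun h' ↦ hβ1.ne (by exact_mod_cast h')
    have h0₁ : famF K ψ₁ (β₁ : ℂ) = 0 :=
      famF_eq_zero_of_classGroupLFunction ψ₁ hβ1ne (by rw [hψ₁]; exact hLz)
    have hexcβ : excRegion c K (β₁ : ℂ) := ⟨Complex.ofReal_im β₁, by rw [Complex.ofReal_re]; exact hβwin⟩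
    have hZ₁ := hexcZ ψ₁ (β₁ : ℂ) h0₁ hexcβ
    have hmult : famMult K ψ₁ (β₁ : ℂ) = 1 := by
      obtain ⟨hs1, hs2⟩ := hLPsimple _ (β₁ : ℂ) hZ₁
      by_cases hψ : ψ₁ = 0
      · subst hψ
        have h := hs1 toHomUnits_toMulHom_zero
        have hne : analyticOrderAt (dedekindZeta₁ K) β₁ ≠ ⊤ := by rw [h]; exact ENat.one_ne_top
        have : (analyticOrderNatAt (dedekindZeta₁ K) β₁ : ℕ∞) = 1 := by
          rw [Nat.cast_analyticOrderNatAt hne, h]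
        rw [famMult, famF_zero]; exact_mod_cast this
      · have h := hs2 (toHomUnits_ne_one hψ)
        have hne : analyticOrderAt (classGroupLFunction₀ K (toMulHom ψ₁).toHomUnits) β₁ ≠ ⊤ := by
          rw [h]; exact ENat.one_ne_top
        have : (analyticOrderNatAt (classGroupLFunction₀ K (toMulHom ψ₁).toHomUnits) β₁ : ℕ∞) = 1 := by
          rw [Nat.cast_analyticOrderNatAt hne, h]
        rw [famMult, famF_of_ne hψ]; exact_mod_cast this
    have hβhalf : 1 / 2 ≤ β₁ := half_le_of_window (N := K) hcn hβwin
    have hβ0 : 0 < β₁ := by linarith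
    have hδlow : c₁ * ThornerZaman.condQn K ^ (-(2 : ℝ)) ≤ 1 - β₁ := heff K hKn χ₁ hreal β₁ hβ1 hLz
    have hrep := hDH' K χ₁ hreal β₁ hβ0 hβ1 hLz
    -- the exceptional sets
    set Exc : AddChar (Additive (ClassGroup (𝓞 K))) ℂ → Finset ℂ :=
      fun ψ ↦ if ψ = ψ₁ then {(β₁ : ℂ)} else ∅ with hExcdef
    have hExc : ∀ ψ, ∀ ρ ∈ Exc ψ, famF K ψ ρ = 0 ∧ 0 < ρ.re ∧ ρ.re < 1 := by
      intro ψ ρ hρ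
      rw [hExcdef] at hρ; dsimp only at hρ
      split_ifs at hρ with hψ
      · rw [Finset.mem_singleton] at hρ; subst hρ; subst hψ
        exact ⟨h0₁, by rw [Complex.ofReal_re]; exact hβ0, by rw [Complex.ofReal_re]; exact hβ1⟩
      · simp at hρ
    have hExc' : ∀ ψ ρ, famF K ψ ρ = 0 → 0 < ρ.re → ρ.re < 1 → excRegion c K ρ → ρ ∈ Exc ψ := by
      intro ψ ρ h0 _ _ hexc
      have hZ := hexcZ ψ ρ h0 hexc
      obtain ⟨hχ, hρρ⟩ := hLPuniq _ _ ρ (β₁ : ℂ) hZ hZ₁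
      have hψ : ψ = ψ₁ := toHomUnits_toMulHom_injective hχ
      rw [hExcdef]; dsimp only; rw [if_pos hψ, Finset.mem_singleton]; exact hρρ
    have hcorr : ∑ ψ : AddChar (Additive (ClassGroup (𝓞 K))) ℂ, ψ (Additive.ofMul Cl⁻¹) *
        ∑ ρ ∈ Exc ψ, (famMult K ψ ρ : ℂ) * fordLaplace (windowTest lo hi (ε₀ * η)) (-ρ) =
        (χ₁ Cl : ℂ) * fordLaplace (windowTest lo hi (ε₀ * η)) (-(β₁ : ℂ)) := by
      rw [Finset.sum_eq_single ψ₁]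
      · rw [hExcdef]; dsimp only
        rw [if_pos rfl, Finset.sum_singleton, hmult, ← toHomUnits_toMulHom_apply, hψ₁,
          classGroupChar_apply_inv_of_real hreal Cl]
        push_cast; ring
      · intro ψ _ hψ
        rw [hExcdef]; dsimp only; rw [if_neg hψ, Finset.sum_empty, mul_zero]
      · intro h; exact absurd (Finset.mem_univ _) h
    -- sizes of `μ₁ = (1 − β₁) log x`
    have hδ₁0 : 0 < 1 - β₁ := by linarith
    have hμ0 : 0 < (1 - β₁) * Real.log x := mul_pos hδ₁0 hL0
    have hL1 : 1 ≤ Real.log x := by linarith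
    have hδμ : 1 - β₁ ≤ (1 - β₁) * Real.log x := le_mul_of_one_le_right hδ₁0.le hL1
    have hμlow : c₁ * ThornerZaman.condQn K ^ (-(2 : ℝ)) ≤ (1 - β₁) * Real.log x := hδlow.trans hδμ
    have hμlow1 : c₁ * ThornerZaman.condQn K ^ (-(2 : ℝ)) ≤ 1 :=
      (mul_le_mul hc₁1 hQm2le hQm2pos.le zero_le_one).trans (by norm_num)
    have hμm : c₁ * ThornerZaman.condQn K ^ (-(2 : ℝ)) ≤ min 1 ((1 - β₁) * Real.log x) := le_min hμlow1 hμlow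
    have hmin0 : 0 ≤ min 1 ((1 - β₁) * Real.log x) := le_min zero_le_one hμ0.le
    have hxη : 0 ≤ x * η := by positivity
    rcases le_or_gt cu ((1 - β₁) * Real.log x) with hAreg | hBreg
    · -- regime A: the classical zero-free region suffices
      have key := hcore c hc hzfr_c Cl Exc hExc hExc'
      rw [hcorr] at key
      refine key.trans ?_
      have hmcu : cu ≤ min 1 ((1 - β₁) * Real.log x) := le_min hcu1 hAreg
      have h1 : 9 / 2 * (2 * Real.exp 1 * D * Real.exp (-(c / (6 * θ)))) ≤
          κ / 2 * min 1 ((1 - β₁) * Real.log x) := by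
        have h3 := mul_le_mul_of_nonneg_left hflatA (by norm_num : (0 : ℝ) ≤ 9 / 2)
        have e : (9 / 2 : ℝ) * tA = κ / 2 * cu := by rw [htA]; ring
        have h4 := mul_le_mul_of_nonneg_left hmcu (by positivity : (0:ℝ) ≤ κ / 2)
        linarith
      have h2 : κ * c₁ / 2 * ThornerZaman.condQn K ^ (-(2 : ℝ)) ≤ κ / 2 * min 1 ((1 - β₁) * Real.log x) := by
        have := mul_le_mul_of_nonneg_left hμm (by positivity : (0:ℝ) ≤ κ / 2)
        linarith
      have hsum : 9 / 2 * (2 * Real.exp 1 * D * Real.exp (-(c / (6 * θ)))) +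
          κ * c₁ / 2 * ThornerZaman.condQn K ^ (-(2 : ℝ)) ≤ κ * min 1 ((1 - β₁) * Real.log x) := by linarith
      have := mul_le_mul_of_nonneg_right (mul_le_mul_of_nonneg_right hsum hx0.le) hη0.le
      refine this.trans (le_of_eq ?_)
      ring
    · -- regime B: Deuring–Heilbronn
      have hμ1 : (1 - β₁) * Real.log x ≤ 1 := hBreg.le.trans hcu1
      have hmin : min 1 ((1 - β₁) * Real.log x) = (1 - β₁) * Real.log x := min_eq_right hμ1
      have hsmall : 2 * C * n * ((1 - β₁) * Real.log x) ≤ 1 / 3 := by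
        have h1 : 2 * C * n * ((1 - β₁) * Real.log x) ≤ 2 * C * n * cu :=
          mul_le_mul_of_nonneg_left hBreg.le (by positivity)
        have h2 : 2 * C * n * cu ≤ 2 * C * n * (1 / (6 * C * n)) :=
          mul_le_mul_of_nonneg_left hcuC (by positivity)
        have h3 : 2 * C * n * (1 / (6 * C * n)) = 1 / 3 := by field_simp; ring
        linarith
      have hL4 : 4 ≤ Real.log x := by linarith
      set cZ : ℝ := min (Real.log (1 / (2 * C * n * ((1 - β₁) * Real.log x))) / (C * n))
          (a * Real.log (ThornerZaman.condQn K) / 2) with hcZ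
      have hcZ0 : 0 < cZ := by
        refine lt_min (div_pos (Real.log_pos ?_) (by positivity)) (by positivity)
        have h0 : 0 < 2 * C * n * ((1 - β₁) * Real.log x) := by positivity
        rw [lt_div_iff₀ h0]; linarith
      have hzfr_x := zfr_of_zeroRepulsion (K := K) hn hKn hC (c := c) (a := a) ha hexcβ hβ1 hQx hL4 hrep hsmall
      have hzfr : ∀ (ψ : AddChar (Additive (ClassGroup (𝓞 K))) ℂ) (ρ : ℂ), famF K ψ ρ = 0 →
          1 / 4 ≤ ρ.re → ρ.re < 1 → |ρ.im| ≤ Real.exp (θ * (hi + ε₀ * η)) → ¬ excRegion c K ρ →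
            ρ.re ≤ 1 - cZ / (a * Real.log (ThornerZaman.condQn K) + Real.log (|ρ.im| + 4)) :=
        fun ψ ρ h0 h14 h1 hγ hexc ↦ hzfr_x ψ ρ h0 h14 h1 (hγ.trans hT₁x) hexc
      have key := hcore cZ hcZ0 hzfr Cl Exc hExc hExc'
      rw [hcorr] at key
      refine key.trans ?_
      rw [hmin]
      have hflatB := dh_flat_le (Q := ThornerZaman.condQn K) (μ₁ := (1 - β₁) * Real.log x) hC hn2 hD ha hθ0 htB0 hc₁
        hQ12 hμ0 hμlow hsmall hθK₃' hθK₄'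
      have h1 : 9 / 2 * (2 * Real.exp 1 * D * Real.exp (-(cZ / (6 * θ)))) ≤
          κ / 2 * ((1 - β₁) * Real.log x) := by
        have := mul_le_mul_of_nonneg_left hflatB (by norm_num : (0 : ℝ) ≤ 9 / 2)
        have e : (9 / 2 : ℝ) * (tB * ((1 - β₁) * Real.log x)) = κ / 2 * ((1 - β₁) * Real.log x) := by
          rw [htB]; ring
        rw [hcZ]; linarith
      have h2 : κ * c₁ / 2 * ThornerZaman.condQn K ^ (-(2 : ℝ)) ≤ κ / 2 * ((1 - β₁) * Real.log x) := by
        have := mul_le_mul_of_nonneg_left hμlow (by positivity : (0:ℝ) ≤ κ / 2)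
        linarith
      have hsum : 9 / 2 * (2 * Real.exp 1 * D * Real.exp (-(cZ / (6 * θ)))) +
          κ * c₁ / 2 * ThornerZaman.condQn K ^ (-(2 : ℝ)) ≤ κ * ((1 - β₁) * Real.log x) := by linarith
      have := mul_le_mul_of_nonneg_right (mul_le_mul_of_nonneg_right hsum hx0.le) hη0.le
      refine this.trans (le_of_eq ?_)
      ring

end Summit.QuantumAdvantage.QuantumAdvantage.Theorems.DegreeOnePrimesEscape

end
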